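import Mathlib
import HarnessLib
import Summits.NavierStokesRegularity.NavierStokesRegularity.Theorems.TaylorModelRungThreeCertificateFormatVRadii
import Summits.NavierStokesRegularity.NavierStokesRegularity.Theorems.TaylorModelRungThreeCertificateCoreStep

/-!
# Crux K1b-DR (stmt-NavierStokesRegularity-23954), line `taylor-model` — v3 checker: the STAGE LOOP of the frame-absorbed
# vector step — hulls, retry of the core step, fresh centre error `ν`, the node recursion `nodeAt`, and the CHUNK checker
# `checkRange` with its soundness (PROPAGATE-V-SPEC-cert1 rev. §2 B/E/F/H, F1 chunking; successor engine-1 g67)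

Generic over the per-sub-step CORE computation (the jet side: boxes, (E2)/(J)/(D1κ)/(V1)/(JU) tests, the one-step derivative
enclosure `M`, `L1` — typer g32's `T.coreStep : CoreIn → CoreOut` of `…CertificateCoreStep`, wrapped by the assembly into
`StageCtx.core`) and over the interval field twin `QBA` (for the CENTRE polynomial, computed here from the point box of `x_s`
by `jetLevelsA`/`polyLevelsA`). Per stage a `StageCtx` carries the sizes/precisions, the box radii `rB`, the tube inflation
half-widths `wT = ΛT·κ·ω`, the trial `L1₀`, the core function, the field twin, the centres `x s`, step sizes `h s`, emitted
node states `E s` (chunk starts) and the entry node state `N0`. Then: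

* `hullRad N = |Vc|·rB + e + |B|·rp` and the outer hull box `hull2 N s = x_s ± (hullRad N + wT)` (PROPAGATE-V-SPEC §2 B with
  tm-g4's 09:41Z correction: jets and `[M]` over H² = H¹ ⊕ ΛT·κ·ω);
* `coreRetry` (three attempts `L1₀, 2L1₀, 4L1₀`); the centre polynomial `tph x h` and
  `nuOf co s = mag(tph ⊖ x_{s+1}) + J·h^(p+1)↑` with `nu_sound`;
* `subStep s N` = core ∘ ν ∘ `stepNext` (+ `nodeOK` of the next state), `nodeAt` (node `0` = `N0`, node `s+1` = the next
  state of sub-step `s`), `nodeOfE`/`startNode` (a chunk starts from the EMITTED state without replaying the prefix;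
  `startNode_eq_nodeAt`), `runFrom`/`checkRange s₀ len` and **`checkRange_sound`**: a passing chunk gives
  `(subStep s (nodeAt s)).ok = true` for every `s ∈ [s₀, s₀+len)`.

No semantics here beyond `nu_sound`; the interpretation `toCertDataV/toBoxes/toRadii` reads `nodeAt`/`subStep` in the
assembly file. MODEL-lattice bookkeeping only (rung TL-M3); nothing here concerns the Navier–Stokes equations.
-/

-- the sub-problem namespace repeats the summit name by design (D-0017)
set_option linter.dupNamespace false

namespace Summit.NavierStokesRegularity.NavierStokesRegularity.Theorems.TaylorModelCert

open scoped BigOperators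

/-- Per-stage CONTEXT of the loop. [folklore] -/
structure StageCtx where
  /-- window size, precisions (interval / `Vc` / frame), jet order -/
  (n prec precV precB p : ℕ)
  /-- polytope box radii `rB ≥ 0` -/
  rB : Array Dyad
  /-- tube inflation half-widths `ΛT·κ·ω ≥ 0` -/
  wT : Array Dyad
  /-- first trial row bound `L1₀` -/
  L1₀ : Dyad
  /-- the core step: `(H2, h, L1) ↦ CoreOut` (one attempt) -/
  core : Array IntervalD → Dyad → Dyad → CoreOut
  /-- the interval twin of the field (for the centre polynomial) -/
  QBA : Array IntervalD → Array IntervalD → Array IntervalD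
  /-- centres `x s` -/
  x : ℕ → Array Dyad
  /-- step sizes `h s` -/
  h : ℕ → Dyad
  /-- emitted node states (chunk starts) -/
  E : ℕ → Option NodeV
  /-- entry node state -/
  N0 : NodeSt

namespace StageCtx

variable (C : StageCtx)

/-- `|Vc|·rB + e + |B|·rp` (upper bound of the half-widths of the level-1 node set around `x`). [folklore] -/
def hullRad (N : NodeSt) : Array Dyad :=
  addVecUp C.n C.prec (addVecUp C.n C.prec (absMulVecUp C.n C.prec (absD C.n N.Vc) C.rB) N.e)
    (absMulVecUp C.n C.prec (absD C.n N.B) N.rp)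

/-- The OUTER HULL box `H² = x_s ± (hullRad N + wT)`. [folklore] -/
def hull2 (N : NodeSt) (s : ℕ) : Array IntervalD := boxAround C.n (C.x s) (addVecUp C.n C.prec (C.hullRad N) C.wT)

/-- The core step with up to three attempts `L1₀, 2L1₀, 4L1₀`. [folklore] -/
def coreRetry (H2 : Array IntervalD) (h : Dyad) : CoreOut :=
  let c₀ := C.core H2 h C.L1₀
  if c₀.ok then c₀ else
    let c₁ := C.core H2 h (Dyad.shift C.L1₀ 1)
    if c₁.ok then c₁ else C.core H2 h (Dyad.shift C.L1₀ 2)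

/-- The point box of a dyadic vector. [folklore] -/
def pointBox (x : Array Dyad) : Array IntervalD := Array.ofFn (n := C.n) fun c => IntervalD.ofDyad (dget x c)

/-- The CENTRE Taylor polynomial at the step end: jets of the point box of `x` to order `p`, Horner at `h`. [folklore] -/
def tph (x : Array Dyad) (h : Dyad) : Array IntervalD :=
  IntervalD.polyLevelsA C.n C.prec (IntervalD.jetLevelsA C.n C.QBA C.prec (C.pointBox x) C.p) C.p (IntervalD.ofDyad h)

/-- Upper bound of `h_s^(p+1)`. [folklore] -/
def hpow (s : ℕ) : Dyad := (IntervalD.powR C.prec (IntervalD.ofDyad (C.h s)) (C.p + 1)).hi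

/-- The fresh centre-error bound `ν_s = mag(tph ⊖ x_{s+1}) + J·h^(p+1)` (rounded up). [folklore] -/
def nuOf (co : CoreOut) (s : ℕ) : Array Dyad :=
  let TP := C.tph (C.x s) (C.h s)
  Array.ofFn (n := C.n) fun c =>
    Dyad.addUp C.prec
      (IntervalD.mag (IntervalD.subR C.prec (IntervalD.aget TP c) (IntervalD.ofDyad (dget (C.x (s + 1)) c))))
      (Dyad.mulUp C.prec (dget co.J c) (C.hpow s))

/-- Output of one full sub-step. [folklore] -/
structure SubOut where
  /-- the core output used -/
  core : CoreOut
  /-- the next node state -/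
  next : NodeSt
  /-- core tests ∧ cross-step tests ∧ next node's frame test -/
  ok : Bool

/-- **One full sub-step** from node state `N` at sub-step `s`. [folklore] -/
def subStep (s : ℕ) (N : NodeSt) : SubOut :=
  let co := C.coreRetry (C.hull2 N s) (C.h s)
  let r := stepNext C.n C.prec C.precV C.precB N co.M C.rB (C.nuOf co s) (C.E (s + 1))
  { core := co, next := r.1, ok := co.ok && r.2 && nodeOK C.n C.prec r.1 }

/-- **The node recursion**: node `0` is the entry state, node `s+1` the next state of sub-step `s`. [folklore] -/
def nodeAt (C : StageCtx) : ℕ → NodeSt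
  | 0 => C.N0
  | s + 1 => (C.subStep s (nodeAt C s)).next

/-- The node state built from an emitted one. [folklore] -/
def nodeOfE (Ev : NodeV) : NodeSt :=
  { mkNode C.n C.prec C.precB Ev.Vc #[] Ev.B #[] #[] with e := Ev.e, rp := Ev.rp, Z := Ev.Z }

/-- Start state of a chunk: the emitted node state at `s` (no replay of the prefix), the entry state at `0`. [folklore] -/
def startNode : ℕ → NodeSt
  | 0 => C.N0
  | s + 1 =>
    match C.E (s + 1) with
    | some Ev => C.nodeOfE Ev
    | none => C.nodeAt (s + 1)

/-- Run `k` sub-steps from sub-step `s` and state `N`, conjoining the Booleans. [folklore] -/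
def runFrom : ℕ → ℕ → NodeSt → Bool
  | 0, _, _ => true
  | k + 1, s, N =>
    let o := C.subStep s N
    o.ok && runFrom k (s + 1) o.next

/-- **CHUNK CHECK**: the `len` sub-steps starting at sub-step `s₀`, from the chunk's start state. [folklore] -/
def checkRange (s₀ len : ℕ) : Bool := C.runFrom len s₀ (C.startNode s₀)

/-! ### Soundness of the loop -/

/-- The next state at an emitted node is the emitted state. [folklore] -/
theorem nodeAt_succ_of_E {s : ℕ} {Ev : NodeV} (hE : C.E (s + 1) = some Ev) : C.nodeAt (s + 1) = C.nodeOfE Ev := by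
  show (C.subStep s (C.nodeAt s)).next = C.nodeOfE Ev
  simp only [subStep, stepNext, chosenVcB, hE, nodeOfE]

/-- A chunk's start state is the node state. [folklore] -/
theorem startNode_eq_nodeAt (s : ℕ) : C.startNode s = C.nodeAt s := by
  cases s with
  | zero => rfl
  | succ s =>
    simp only [startNode]
    cases hE : C.E (s + 1) with
    | none => rfl
    | some Ev => exact (C.nodeAt_succ_of_E hE).symm

/-- `runFrom` from the true node state certifies every sub-step it runs. [folklore] -/
theorem runFrom_sound : ∀ (k s : ℕ), C.runFrom k s (C.nodeAt s) = true →
    ∀ i, i < k → (C.subStep (s + i) (C.nodeAt (s + i))).ok = true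
  | 0, _, _, i, hi => absurd hi (Nat.not_lt_zero i)
  | k + 1, s, h, i, hi => by
    simp only [runFrom, Bool.and_eq_true] at h
    obtain ⟨h0, hrest⟩ := h
    have hnext : (C.subStep s (C.nodeAt s)).next = C.nodeAt (s + 1) := rfl
    rw [hnext] at hrest
    cases i with
    | zero => simpa using h0
    | succ i =>
      have := runFrom_sound k (s + 1) hrest i (Nat.lt_of_succ_lt_succ hi)
      simpa only [Nat.add_succ, Nat.succ_add] using this

/-- **Soundness of the chunk check**: every sub-step of the range passes from the true node state. [folklore] -/
theorem checkRange_sound {s₀ len : ℕ} (h : C.checkRange s₀ len = true) {s : ℕ} (hs₀ : s₀ ≤ s) (hs : s < s₀ + len) :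
    (C.subStep s (C.nodeAt s)).ok = true := by
  unfold checkRange at h
  rw [C.startNode_eq_nodeAt] at h
  obtain ⟨i, rfl⟩ := Nat.exists_eq_add_of_le hs₀
  exact C.runFrom_sound len s₀ h i (by omega)

/-- From a passing sub-step: the core tests, the cross-step tests and the next node's frame test. [folklore] -/
theorem subStep_ok_iff (s : ℕ) (N : NodeSt) :
    (C.subStep s N).ok = true ↔
      (C.subStep s N).core.ok = true ∧
      (stepNext C.n C.prec C.precV C.precB N (C.subStep s N).core.M C.rB (C.nuOf (C.subStep s N).core s)
          (C.E (s + 1))).2 = true ∧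
      nodeOK C.n C.prec (C.subStep s N).next = true := by
  simp only [subStep, Bool.and_eq_true, and_assoc]

/-- **Soundness of `ν`** (clause (R3) in coordinates): if `tp c ∈ (tph x_s h_s)[c]` and `0 ≤ J_c`, then
`|tp c − x_{s+1,c}| + J_c·h^(p+1) ≤ ν_c`. [folklore] -/
theorem nu_sound (co : CoreOut) (s : ℕ) {tp : ℕ → ℝ}
    (hTP : ∀ c < C.n, IntervalD.mem (tp c) (IntervalD.aget (C.tph (C.x s) (C.h s)) c))
    (hJ : ∀ c < C.n, 0 ≤ vre co.J c) {c : ℕ} (hc : c < C.n) :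
    |tp c - vre (C.x (s + 1)) c| + vre co.J c * (C.h s).toReal ^ (C.p + 1) ≤ vre (C.nuOf co s) c := by
  unfold nuOf vre
  simp only [dget_ofFn _ hc]
  refine le_trans (add_le_add ?_ ?_) (Dyad.add_le_addUp C.prec _ _)
  · exact IntervalD.abs_le_mag (IntervalD.mem_subR C.prec (hTP c hc) (IntervalD.mem_ofDyad _))
  · refine le_trans (mul_le_mul_of_nonneg_left ?_ (hJ c hc)) (Dyad.mul_le_mulUp C.prec _ _)
    exact (IntervalD.mem_powR C.prec (IntervalD.mem_ofDyad (C.h s)) (C.p + 1)).2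

end StageCtx

end Summit.NavierStokesRegularity.NavierStokesRegularity.Theorems.TaylorModelCert
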